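import Summits.MatrixMultiplication.OmegaCensus.RCycLift
import Summits.MatrixMultiplication.OmegaCensus.BoxRatioSectionLawAtoms
import Summits.MatrixMultiplication.OmegaCensus.DihedralClassification
import Summits.MatrixMultiplication.OmegaCensus.FrobeniusAll
import Summits.MatrixMultiplication.OmegaCensus.EisClassTable

/-!
# ω-census, family (b3): conjecture C9 (b) — the atoms with `q ∈ {2, 3}` in relation form; C9 (b) for solvable groups modulo the atoms `A(p,q)`, `q ≥ 5`

HONEST FRAMING (pub-omega census; verbatim): lottery ticket; floor = certified bounds/negative ranges.
Census BOOKKEEPING (conjecture C9 of the cell, STRUCTURE.md §2, `BoxRatioSectionLaw`; pub-omega kernel-l4 gen 17, task K-5″).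
Nothing here is progress on `ω`.

The cell's CONCRETE box-useless models — the dihedral groups `D_{2m}` (`not_boxUseful_dihedral`, stpp-1), the Frobenius groups
`ℤ/p ⋊_u ℤ/3` (`MetaCyc.not_boxUseful_frobenius3`, stpp-1) and the Eisenstein groups `𝔽_p[ω] ⋊ ℤ/3`
(`EisCyc.not_boxUseful`, stpp-1) — are turned into RELATION-FORM theorems about an arbitrary finite group `G` through the
universal property of `R ⋊_u ℤ/n` (`RCycLift`): embed `R ⋊_u ℤ/n ↪ G` with `n = |y|`, then reduce `ℤ/n ↠ ℤ/q`.
* `not_boxUseful_of_inverted` — `a` of odd order `m ≥ 5` and ANY `y` with `y a y⁻¹ = a⁻¹` ⇒ `G` is not box-useful.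
* `not_boxUseful_of_frobenius3` — `a` of prime order `p ≠ 3`, `y a y⁻¹ = a^k` with `k² + k + 1 ≡ 0 (mod p)` ⇒ not box-useful.
* `not_boxUseful_of_eisenstein` — `a` of prime order `p ≠ 3`, `b ∉ ⟨a⟩` commuting with `a`, `b^p = 1`, `y a y⁻¹ = b`,
  `y b y⁻¹ = a⁻¹ b⁻¹` ⇒ not box-useful.
Hence the ATOM HYPOTHESIS (`AtomBad`, `BoxUsefulAtomConfig`) holds for `q = 2`, `p ≥ 5` (`atomBad_two`) and for `q = 3`, every
prime `p ≠ 3` (`atomBad_three`; `p = 2` is `A₄`), and the reduction of `BoxRatioSectionLawAtoms` needs the atoms only for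
`q ≥ 5`: **`boxRatioSectionLaw_of_isSolvable_of_atomBad_five` — if every finite group carrying an `AtomConfig p q` with `p ≠ q`
primes and `q ≥ 5` is box-useless, then C9 (b) holds for every finite solvable group** (and `BoxRatioSectionLaw` itself, given
in addition that non-solvable groups are box-useless).  The remaining atoms `A(p,q)`, `q ≥ 5`, are exactly the open part of the
cell's atom lane (stpp-1: `A(2,5)`, `A(3,5)` and finitely many `ℤ/p ⋊ ℤ/5`, `ℤ/p ⋊ ℤ/7`, `ℤ/p ⋊ ℤ/11` are in the tree as models).
-/

namespace Summit.MatrixMultiplication.OmegaCensus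

open KeyLift

universe u

variable {G : Type*} [Group G] [Fintype G] [DecidableEq G]

/-- `(q : ZMod p) = 0` for primes `p ≠ q`, `q` prime, is impossible. [folklore] -/
theorem natCast_ne_zero_of_prime_ne {p q : ℕ} (hp : p.Prime) (hq : q.Prime) (hpq : p ≠ q) : (q : ZMod p) ≠ 0 := by
  haveI : NeZero p := ⟨hp.ne_zero⟩
  intro h
  rw [ZMod.natCast_eq_zero_iff] at h
  exact hpq ((Nat.prime_dvd_prime_iff_eq hp hq).1 h)

/-- **Dihedral configuration, relation form.** An element `a` of odd order `m ≥ 5` inverted by some `y` (of any order) makes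
`G` box-useless: `⟨a, y⟩ ≅ ℤ/m ⋊_{-1} ℤ/|y|` embeds, and reduces onto `ℤ/m ⋊_{-1} ℤ/2 ≅ D_{2m}`, which is box-useless
(`not_boxUseful_dihedral`). [folklore] -/
theorem not_boxUseful_of_inverted {a y : G} {m : ℕ} (hm : Odd m) (h5 : 5 ≤ m) (ha : orderOf a = m)
    (hy : y * a * y⁻¹ = a⁻¹) : ¬ BoxUseful G := by
  classical
  haveI : NeZero m := ⟨by omega⟩
  have ham : a ^ m = 1 := by rw [← ha]; exact pow_orderOf_eq_one a
  haveI : NeZero (orderOf y) := ⟨(orderOf_pos y).ne'⟩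
  let e : Multiplicative (ZMod m) →* G := cycHom m a ham
  have he : Function.Injective e := cycHom_injective m a ham ha
  have hy' : ∀ r : ZMod m, y * e (Multiplicative.ofAdd r) * y⁻¹ = e (Multiplicative.ofAdd ((-1 : ZMod m) * r)) := by
    intro r
    change y * a ^ r.val * y⁻¹ = cycHom m a ham (Multiplicative.ofAdd (-1 * r))
    rw [neg_one_mul, ofAdd_neg, map_inv, cycHom_ofAdd, ← MulAut.conj_apply, map_pow, MulAut.conj_apply, hy, inv_pow]
  haveI hfact : Fact ((-1 : ZMod m) ^ orderOf y = 1) := ⟨RCyc.pow_orderOf_smul_eq e he y hy'⟩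
  have hyn : y ^ orderOf y = 1 := pow_orderOf_eq_one y
  have hinj : Function.Injective (RCyc.lift e y hyn hy') := by
    refine RCyc.lift_injective e y hyn hy' he fun t r htr => ?_
    have hc : y * y ^ t.val * y⁻¹ = y ^ t.val := by group
    rw [htr, hy' r, neg_one_mul, ofAdd_neg, map_inv] at hc
    have h2 : e (Multiplicative.ofAdd r) ^ 2 = 1 := by
      rw [pow_two]; nth_rw 1 [← hc]; exact inv_mul_cancel _
    change (a ^ r.val) ^ 2 = 1 at h2
    rw [← pow_mul] at h2
    have hdvd : m ∣ r.val * 2 := by have := orderOf_dvd_of_pow_eq_one h2; rwa [ha] at this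
    have hdvd' : m ∣ r.val := (Nat.coprime_two_right.2 hm).dvd_of_dvd_mul_right hdvd
    have hr0 : r.val = 0 := Nat.eq_zero_of_dvd_of_lt hdvd' (ZMod.val_lt r)
    have hyt : y ^ t.val = 1 := by rw [htr]; change a ^ r.val = 1; rw [hr0, pow_zero]
    have ht : orderOf y ∣ t.val := orderOf_dvd_of_pow_eq_one hyt
    exact (ZMod.val_eq_zero t).1 (Nat.eq_zero_of_dvd_of_lt ht (ZMod.val_lt t))
  have h2n : 2 ∣ orderOf y := by
    rcases Nat.even_or_odd (orderOf y) with h | h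
    · exact h.two_dvd
    · exfalso
      have h1 := hfact.out
      rw [h.neg_one_pow] at h1
      have h2 : ((2 : ℕ) : ZMod m) = 0 := by push_cast; linear_combination -h1
      rw [ZMod.natCast_eq_zero_iff 2 m] at h2
      have := Nat.le_of_dvd (by norm_num) h2
      omega
  have hD : ¬ BoxUseful (RCyc (ZMod m) 2 (-1 : ZMod m)) :=
    not_boxUseful_of_injective' (DihedralGroup.toRCyc m) (DihedralGroup.toRCyc_injective m)
      (not_boxUseful_dihedral h5 (by rintro rfl; exact absurd hm (by decide)))
  have hM : ¬ BoxUseful (RCyc (ZMod m) (orderOf y) (-1 : ZMod m)) :=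
    not_boxUseful_of_surjective' (RCyc.redHom h2n) (RCyc.redHom_surjective h2n) hD
  exact not_boxUseful_of_injective' _ hinj hM

/-- **Frobenius-`3` configuration, relation form.** An element `a` of prime order `p ≠ 3` and some `y` (of any order) with
`y a y⁻¹ = a^k`, `k² + k + 1 ≡ 0 (mod p)`, make `G` box-useless: `⟨a, y⟩ ≅ ℤ/p ⋊_k ℤ/|y|` embeds and reduces onto the Frobenius
group `ℤ/p ⋊_k ℤ/3` (`MetaCyc.not_boxUseful_frobenius3`). [folklore] -/
theorem not_boxUseful_of_frobenius3 {a y : G} {p : ℕ} (hp : p.Prime) (hp3 : p ≠ 3) (ha : orderOf a = p) {k : ℕ}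
    (hy : y * a * y⁻¹ = a ^ k) (hk : ((k : ZMod p)) ^ 2 + k + 1 = 0) : ¬ BoxUseful G := by
  classical
  haveI : Fact p.Prime := ⟨hp⟩
  haveI : NeZero p := ⟨hp.ne_zero⟩
  set u : ZMod p := (k : ZMod p) with hu
  have hu3 : u ^ 3 = 1 := by linear_combination (u - 1) * hk
  have hu1 : u ≠ 1 := by
    intro h1
    rw [h1] at hk
    have h3 : ((3 : ℕ) : ZMod p) = 0 := by push_cast; linear_combination hk
    exact natCast_ne_zero_of_prime_ne hp Nat.prime_three hp3 h3
  haveI : Fact (u ^ 3 = 1) := ⟨hu3⟩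
  have hap : a ^ p = 1 := by rw [← ha]; exact pow_orderOf_eq_one a
  haveI : NeZero (orderOf y) := ⟨(orderOf_pos y).ne'⟩
  let e : Multiplicative (ZMod p) →* G := cycHom p a hap
  have he : Function.Injective e := cycHom_injective p a hap ha
  have hak : a ^ k = a ^ u.val := by rw [hu, ZMod.val_natCast, pow_mod_eq_of_pow_eq_one hap]
  have hy' : ∀ r : ZMod p, y * e (Multiplicative.ofAdd r) * y⁻¹ = e (Multiplicative.ofAdd (u * r)) := by
    intro r
    change y * a ^ r.val * y⁻¹ = a ^ (u * r).val
    rw [← MulAut.conj_apply, map_pow, MulAut.conj_apply, hy, hak, ← pow_mul, ZMod.val_mul,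
      pow_mod_eq_of_pow_eq_one hap]
  haveI hfact : Fact (u ^ orderOf y = 1) := ⟨RCyc.pow_orderOf_smul_eq e he y hy'⟩
  have hyn : y ^ orderOf y = 1 := pow_orderOf_eq_one y
  have hinj : Function.Injective (RCyc.lift e y hyn hy') := by
    refine RCyc.lift_injective e y hyn hy' he fun t r htr => ?_
    have hc : y * y ^ t.val * y⁻¹ = y ^ t.val := by group
    rw [htr, hy' r] at hc
    have hr : u * r = r := Multiplicative.ofAdd.injective (he hc)
    have hr0 : r = 0 := by
      have : (u - 1) * r = 0 := by linear_combination hr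
      rcases mul_eq_zero.1 this with h | h
      · exact absurd (sub_eq_zero.1 h) hu1
      · exact h
    have hyt : y ^ t.val = 1 := by rw [htr, hr0]; change a ^ (0 : ZMod p).val = 1; rw [ZMod.val_zero, pow_zero]
    have ht : orderOf y ∣ t.val := orderOf_dvd_of_pow_eq_one hyt
    exact (ZMod.val_eq_zero t).1 (Nat.eq_zero_of_dvd_of_lt ht (ZMod.val_lt t))
  have h3n : 3 ∣ orderOf y := by
    rw [← orderOf_eq_prime hu3 hu1]
    exact orderOf_dvd_of_pow_eq_one hfact.out
  have hF : ¬ BoxUseful (RCyc (ZMod p) 3 u) :=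
    not_boxUseful_of_injective' (MetaCyc.toRCyc p 3 u) (MetaCyc.toRCyc_injective p 3 u)
      (MetaCyc.not_boxUseful_frobenius3 hp3 u hk)
  have hM : ¬ BoxUseful (RCyc (ZMod p) (orderOf y) u) :=
    not_boxUseful_of_surjective' (RCyc.redHom h3n) (RCyc.redHom_surjective h3n) hF
  exact not_boxUseful_of_injective' _ hinj hM

omit [Fintype G] [DecidableEq G] in
/-- The additive character `𝔽_p[ω] → G`, `x + z ω ↦ a^x b^z`, for commuting `a, b` with `a^p = b^p = 1`. [folklore] -/
def eisHom {p : ℕ} [NeZero p] (a b : G) (hap : a ^ p = 1) (hbp : b ^ p = 1) (hab : Commute a b) :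
    Multiplicative (Eis p) →* G where
  toFun z := a ^ (Multiplicative.toAdd z).re.val * b ^ (Multiplicative.toAdd z).im.val
  map_one' := by simp
  map_mul' z w := by
    simp only [toAdd_mul, QuadraticAlgebra.re_add, QuadraticAlgebra.im_add, ZMod.val_add,
      pow_mod_eq_of_pow_eq_one hap, pow_mod_eq_of_pow_eq_one hbp, pow_add]
    exact (hab.pow_pow _ _).mul_mul_mul_comm _ _

omit [Fintype G] [DecidableEq G] in
/-- Value of `eisHom` on `ofAdd z`. [folklore] -/
theorem eisHom_ofAdd {p : ℕ} [NeZero p] (a b : G) (hap : a ^ p = 1) (hbp : b ^ p = 1) (hab : Commute a b) (z : Eis p) :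
    eisHom a b hap hbp hab (Multiplicative.ofAdd z) = a ^ z.re.val * b ^ z.im.val := rfl

/-- **Eisenstein configuration, relation form.** `a` of prime order `p ≠ 3`, `b ∉ ⟨a⟩` commuting with `a`, `b^p = 1`, and some
`y` (of any order) with `y a y⁻¹ = b`, `y b y⁻¹ = a⁻¹ b⁻¹` make `G` box-useless: `⟨a, b, y⟩ ≅ 𝔽_p[ω] ⋊_ω ℤ/|y|` embeds and
reduces onto `𝔽_p[ω] ⋊ ℤ/3 = EisCyc p` (`EisCyc.not_boxUseful`). [folklore] -/
theorem not_boxUseful_of_eisenstein {a b y : G} {p : ℕ} (hp : p.Prime) (hp3 : p ≠ 3) (ha : orderOf a = p)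
    (hbp : b ^ p = 1) (hab : a * b = b * a) (hb : b ∉ Subgroup.zpowers a) (hya : y * a * y⁻¹ = b)
    (hyb : y * b * y⁻¹ = a⁻¹ * b⁻¹) : ¬ BoxUseful G := by
  classical
  haveI : Fact p.Prime := ⟨hp⟩
  haveI : NeZero p := ⟨hp.ne_zero⟩
  have hap : a ^ p = 1 := by rw [← ha]; exact pow_orderOf_eq_one a
  have habc : Commute a b := hab
  haveI : NeZero (orderOf y) := ⟨(orderOf_pos y).ne'⟩
  let e : Multiplicative (Eis p) →* G := eisHom a b hap hbp habc
  -- `e` is injective since `b ∉ ⟨a⟩`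
  have he : Function.Injective e := by
    rw [injective_iff_map_eq_one]
    intro z hz
    change a ^ (Multiplicative.toAdd z).re.val * b ^ (Multiplicative.toAdd z).im.val = 1 at hz
    set x := (Multiplicative.toAdd z).re with hx
    set w := (Multiplicative.toAdd z).im with hw
    have hw0 : w = 0 := by
      by_contra hw0
      apply hb
      have hbw : b ^ w.val = (a ^ x.val)⁻¹ := eq_inv_of_mul_eq_one_right hz
      have hmem : b ^ w.val ∈ Subgroup.zpowers a := by
        rw [hbw]; exact Subgroup.inv_mem _ (Subgroup.pow_mem _ (Subgroup.mem_zpowers a) _)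
      have hone : (w * w⁻¹).val = 1 := by rw [mul_inv_cancel₀ hw0, ZMod.val_one]
      have hb1 : b = (b ^ w.val) ^ (w⁻¹).val := by
        rw [← pow_mul, ← pow_mod_eq_of_pow_eq_one hbp, ← ZMod.val_mul, hone, pow_one]
      rw [hb1]
      exact Subgroup.pow_mem _ hmem _
    rw [hw0, ZMod.val_zero, pow_zero, mul_one] at hz
    have hx0 : x = 0 := by
      have hdvd : p ∣ x.val := by have := orderOf_dvd_of_pow_eq_one hz; rwa [ha] at this
      exact (ZMod.val_eq_zero x).1 (Nat.eq_zero_of_dvd_of_lt hdvd (ZMod.val_lt x))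
    have : Multiplicative.toAdd z = 0 := QuadraticAlgebra.ext hx0 hw0
    exact toAdd_eq_zero.1 this
  -- the twist by `ω`
  have hy' : ∀ r : Eis p, y * e (Multiplicative.ofAdd r) * y⁻¹ = e (Multiplicative.ofAdd (Eis.w * r)) := by
    intro r
    have hwr : Eis.w * r = ⟨-r.im, r.re - r.im⟩ := by
      ext
      · simp [Eis.w]
      · simp [Eis.w]; ring
    rw [hwr, eisHom_ofAdd, eisHom_ofAdd]
    change y * (a ^ r.re.val * b ^ r.im.val) * y⁻¹ = a ^ (-r.im).val * b ^ (r.re - r.im).val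
    have e1 : a ^ (-r.im).val = (a ^ r.im.val)⁻¹ := by
      rw [← cycHom_ofAdd p a hap, ← cycHom_ofAdd p a hap, ofAdd_neg, map_inv]
    have e2 : b ^ (r.re - r.im).val = b ^ r.re.val * (b ^ r.im.val)⁻¹ := by
      rw [← cycHom_ofAdd p b hbp, ← cycHom_ofAdd p b hbp, ← cycHom_ofAdd p b hbp, sub_eq_add_neg, ofAdd_add,
        ofAdd_neg, map_mul, map_inv]
    have lhs : y * (a ^ r.re.val * b ^ r.im.val) * y⁻¹ = (y * a * y⁻¹) ^ r.re.val * (y * b * y⁻¹) ^ r.im.val := by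
      rw [← MulAut.conj_apply, map_mul, map_pow, map_pow, MulAut.conj_apply, MulAut.conj_apply]
    rw [e1, e2, lhs, hya, hyb, habc.inv_inv.mul_pow, inv_pow, inv_pow]
    have c1 : Commute (b ^ r.re.val) (a ^ r.im.val)⁻¹ := ((habc.pow_pow r.im.val r.re.val).symm).inv_right
    rw [← mul_assoc, c1.eq, mul_assoc]
  haveI hfact : Fact ((Eis.w : Eis p) ^ orderOf y = 1) := ⟨RCyc.pow_orderOf_smul_eq e he y hy'⟩
  have hyn : y ^ orderOf y = 1 := pow_orderOf_eq_one y
  have h3 : (3 : ZMod p) ≠ 0 := by exact_mod_cast natCast_ne_zero_of_prime_ne hp Nat.prime_three hp3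
  have hinj : Function.Injective (RCyc.lift e y hyn hy') := by
    refine RCyc.lift_injective e y hyn hy' he fun t r htr => ?_
    have hc : y * y ^ t.val * y⁻¹ = y ^ t.val := by group
    rw [htr, hy' r] at hc
    have hr : Eis.w * r = r := Multiplicative.ofAdd.injective (he hc)
    have hre := congrArg QuadraticAlgebra.re hr
    have him := congrArg QuadraticAlgebra.im hr
    simp only [QuadraticAlgebra.re_mul, QuadraticAlgebra.im_mul, Eis.w] at hre him
    have him0 : r.im = 0 := by
      have : (3 : ZMod p) * r.im = 0 := by linear_combination -hre - him
      rcases mul_eq_zero.1 this with h | h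
      · exact absurd h h3
      · exact h
    have hre0 : r.re = 0 := by rw [him0] at hre; linear_combination -hre
    have hr0 : r = 0 := QuadraticAlgebra.ext hre0 him0
    have hyt : y ^ t.val = 1 := by rw [htr, hr0, ofAdd_zero, map_one]
    have ht : orderOf y ∣ t.val := orderOf_dvd_of_pow_eq_one hyt
    exact (ZMod.val_eq_zero t).1 (Nat.eq_zero_of_dvd_of_lt ht (ZMod.val_lt t))
  have hw1 : (Eis.w : Eis p) ≠ 1 := by
    intro h
    have him := congrArg QuadraticAlgebra.im h
    change (1 : ZMod p) = 0 at him
    exact one_ne_zero him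
  have h3n : 3 ∣ orderOf y := by
    rw [← orderOf_eq_prime Eis.w_cube hw1]
    exact orderOf_dvd_of_pow_eq_one hfact.out
  have hE : ¬ BoxUseful (RCyc (Eis p) 3 Eis.w) := EisCyc.not_boxUseful
  have hM : ¬ BoxUseful (RCyc (Eis p) (orderOf y) Eis.w) :=
    not_boxUseful_of_surjective' (RCyc.redHom h3n) (RCyc.redHom_surjective h3n) hE
  exact not_boxUseful_of_injective' _ hinj hM

/-! ### The atom hypothesis for `q = 2` and `q = 3` -/

/-- **`AtomBad p 2` for every prime `p ≥ 5`** (the dihedral atoms `A(p,2) = D_{2p}`, relation form). [folklore] -/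
theorem atomBad_two {p : ℕ} (hp : p.Prime) (hp5 : 5 ≤ p) : AtomBad.{u} p 2 := by
  intro H _ _ _ a y h
  haveI : Fact p.Prime := ⟨hp⟩
  obtain ⟨h1, hap, -, -, ht⟩ := h
  rw [conjTrace_succ', conjTrace_succ', conjTrace_zero] at ht
  simp only [pow_zero, pow_one, one_mul, inv_one, mul_one] at ht
  have hy : y * a * y⁻¹ = a⁻¹ := eq_inv_of_mul_eq_one_right ht
  exact not_boxUseful_of_inverted (hp.odd_of_ne_two (by omega)) hp5 (orderOf_eq_prime hap h1) hy

/-- **`AtomBad p 3` for every prime `p ≠ 3`** (the atoms `A(p,3)`: `A₄` for `p = 2`, `ℤ/p ⋊ ℤ/3` or `𝔽_p[ω] ⋊ ℤ/3` otherwise,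
relation form; case split on whether `y a y⁻¹ ∈ ⟨a⟩`). [folklore] -/
theorem atomBad_three {p : ℕ} (hp : p.Prime) (hp3 : p ≠ 3) : AtomBad.{u} p 3 := by
  intro H _ _ _ a y h
  classical
  haveI : Fact p.Prime := ⟨hp⟩
  by_cases hp2 : p = 2
  · subst hp2; exact h.not_boxUseful_two_three
  obtain ⟨h1, hap, hc, -, ht⟩ := h
  have ha : orderOf a = p := orderOf_eq_prime hap h1
  rw [conjTrace_succ', conjTrace_succ', conjTrace_succ', conjTrace_zero] at ht
  simp only [pow_zero, pow_one, one_mul, inv_one, mul_one] at ht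
  -- `ht : a * (y a y⁻¹) * (y² a y⁻²) = 1`
  set b := y * a * y⁻¹ with hb
  have hab : a * b = b * a := by
    have := (hc 0 1).eq; simpa using this
  have habc : Commute a b := hab
  have hbp : b ^ p = 1 := by
    rw [hb, ← MulAut.conj_apply, ← map_pow, hap, map_one]
  have hyb : y * b * y⁻¹ = a⁻¹ * b⁻¹ := by
    have e2 : y * b * y⁻¹ = y ^ 2 * a * (y ^ 2)⁻¹ := by rw [hb, pow_two]; group
    rw [e2, eq_inv_of_mul_eq_one_right ht, mul_inv_rev, habc.inv_inv.eq]
  by_cases hmem : b ∈ Subgroup.zpowers a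
  · -- rank one: `b = a^k` with `k² + k + 1 ≡ 0`
    obtain ⟨k, hk⟩ := (Submonoid.mem_powers_iff _ _).1
      (((isOfFinOrder_of_finite a).mem_powers_iff_mem_zpowers).2 hmem)
    have hy : y * a * y⁻¹ = a ^ k := hk.symm
    -- `y b y⁻¹ = (y a y⁻¹)^k = a^{k²}` and `= a⁻¹ b⁻¹ = (a^{k+1})⁻¹`
    have hk2 : a ^ (k * k + (k + 1)) = 1 := by
      have h1' : y * b * y⁻¹ = a ^ (k * k) := by
        rw [← hk, ← MulAut.conj_apply, map_pow, MulAut.conj_apply, hy, ← pow_mul]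
      have hkk : a ^ (k * k) = (a ^ (k + 1))⁻¹ := by
        rw [← h1', hyb, ← hk, pow_succ, mul_inv_rev]
      rw [pow_add, hkk, inv_mul_cancel]
    have hdvd : p ∣ k * k + (k + 1) := by rw [← ha]; exact orderOf_dvd_of_pow_eq_one hk2
    haveI : NeZero p := ⟨hp.ne_zero⟩
    have hkz : ((k * k + (k + 1) : ℕ) : ZMod p) = 0 := (ZMod.natCast_eq_zero_iff _ p).2 hdvd
    have hk' : ((k : ZMod p)) ^ 2 + k + 1 = 0 := by push_cast at hkz; linear_combination hkz
    exact not_boxUseful_of_frobenius3 hp hp3 ha hy hk'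
  · exact not_boxUseful_of_eisenstein hp hp3 ha hbp hab hmem hb.symm hyb

/-- The atom hypothesis for all pairs with `q < 5` needed by the reduction (`max(p,q) ≥ 5`). [folklore] -/
theorem atomBad_of_lt_five {p q : ℕ} (hp : p.Prime) (hq : q.Prime) (hpq : p ≠ q) (h5 : 5 ≤ p ∨ 5 ≤ q) (hq5 : q < 5) :
    AtomBad.{u} p q := by
  have hq23 : q = 2 ∨ q = 3 := by
    interval_cases q <;> first | (left; rfl) | (right; rfl) | exact absurd hq (by norm_num)
  rcases hq23 with rfl | rfl
  · exact atomBad_two hp (by omega)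
  · exact atomBad_three hp hpq

/-- **C9 (b) for every finite solvable group, modulo the atoms `A(p,q)` with `q ≥ 5`**: if every finite group carrying an
`AtomConfig p q` (`p ≠ q` primes, `q ≥ 5`) is box-useless, then every box-useful finite solvable group has centre of index
`1`, `4` or `6`, or lies in `𝒞₂`. [folklore] -/
theorem boxRatioSectionLaw_of_isSolvable_of_atomBad_five
    (hAtom : ∀ p q : ℕ, p.Prime → q.Prime → p ≠ q → 5 ≤ q → AtomBad.{u} p q)
    (H : Type u) [Group H] [Fintype H] [DecidableEq H] [IsSolvable H] (hH : BoxUseful H) :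
    (Subgroup.center H).index = 1 ∨ (Subgroup.center H).index = 4 ∨ (Subgroup.center H).index = 6 ∨
      ∃ (c₁ c₂ : H) (κ₁ κ₂ ε : H → ZMod 3), DihC3Sq.Coord2 c₁ c₂ κ₁ κ₂ ε := by
  refine boxRatioSectionLaw_of_isSolvable_of_atomBad (fun p q hp hq hpq h5 => ?_) H hH
  by_cases hq5 : 5 ≤ q
  · exact hAtom p q hp hq hpq hq5
  · exact atomBad_of_lt_five hp hq hpq h5 (not_le.1 hq5)

/-- **`BoxRatioSectionLaw` modulo the atoms `A(p,q)`, `q ≥ 5`, and the non-solvable groups.** [folklore] -/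
theorem boxRatioSectionLaw_of_atomBad_five_of_nonsolvable
    (hAtom : ∀ p q : ℕ, p.Prime → q.Prime → p ≠ q → 5 ≤ q → AtomBad.{0} p q)
    (hNS : ∀ (H : Type) [Group H] [Fintype H] [DecidableEq H], ¬ IsSolvable H → ¬ BoxUseful H) :
    BoxRatioSectionLaw := by
  intro H _ _ _ hH
  by_cases hs : IsSolvable H
  · exact boxRatioSectionLaw_of_isSolvable_of_atomBad_five hAtom H hH
  · exact absurd hH (hNS H hs)

end Summit.MatrixMultiplication.OmegaCensus
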